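import Summits.QuantumFields.BalabanUV.T4Continuum.Support.NE9AnalyticFixedPoint
import Summits.QuantumFields.BalabanUV.T4Continuum.Support.SubstrateComplexBackground

/-!
# NE9ComplexBackgroundOfContraction — A UNIFORM CONTRACTION, ANALYTIC IN THE PARAMETER, INHABITS THE SUBSTRATE'S D-8 (v) INTERFACE
# `SubstrateComplexBackground.ComplexBackgroundFamily` ON THE PRESCRIBED PARAMETER BALL, WITH UNIQUENESS AND THE A-PRIORI BOUND
# (route R2 «`cur` AS A BANACH FIXED POINT» of `t4/ROUTES-NE9.md` v1, step B4 — the adapter; sibling of the owner's T32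
# `NE9ComplexBackgroundOfImplicit`, which it does NOT modify; cell `pub-balaban`, T4-DAG §2 node U3 ∕ §6 NE9;
# unit `b2b-balaban-t4-ne9-formalise-leaf-03`, generation 37; Summits-side NEW work, nothing printed asserted)

HONEST FRAMING (T4-DAG PAGE 1).  Rung (B)+1 of the FINITE-VOLUME T⁴ programme — NOT infinite volume, NOT a mass gap, NOT
the Clay problem.  NE9 (`T4OutputRate.NE9` ∧ `FadingMemory`) is a cell NEW ESTIMATE, NOT PRINTED in [I] = CMP **109**, [II] =
CMP **116**, and NOT PROVED here («NE9 ⇐ the named binders»; spine PROVED 0∕9).  HONEST DEPENDENCY (cell line, verbatim):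
continuum YM on T⁴ ⇐ BetaPertH ∧ nine spine estimates (0/9 proved); BetaPertH ⇐ (D1) ∧ (D4) ∧ CAP+tail; G-an2-4 gates asym,
D1 and NE2/3/4.  MECHANISM ONLY: NOTHING here constructs Bałaban's background field or the map (1.13) on concrete carriers (route
R2 step B2 = socket C19′), and the two inequalities that make that map a self-map and a contraction at complex data (step B3;
displayed-type binders `QuadAnalytic` ∕ `‖H‖ ≤ b` of `B13Contraction113`, GAPS G-B13-02) are HYPOTHESES here (`hmaps`, `hlip`).

WHAT.  The owner's T32 `NE9ComplexBackgroundOfImplicit.exists_complexBackgroundFamily_of_implicit` inhabits the substrate interface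
from a holomorphic non-degenerate criticality map by the implicit function theorem and says so: «`∃ ρ > 0` … The radius is NOT
controlled».  Route R2 (t4-ne9-idea-1, prediction P-R2-3: «if T32's consumers need the family on a PRESCRIBED ball (H-quant) rather
than "∃ ρ > 0", R2 is the only typed source of that radius in the cell today») replaces the criticality map by print's contraction
([II] p. 5 (1.13)); with `NE9AnalyticFixedPoint.exists_analyticOnNhd_fixedPt_section` the family then lives on the PRESCRIBED
parameter ball `ball 0 ρ`, takes values in the PRESCRIBED closed ball about the background of record, is UNIQUE there, and obeys
`dist (uC ξ) R ≤ dist (T ξ R) R ∕ (1 − K)`: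
* **`exists_complexBackgroundFamily_of_contraction`** (group-valued unknown; partner side by `ComplexBackgroundFamily.ofInvertible`,
  so bond-wise invertibility on the closed ball about `R0` is a hypothesis — for the record's unitary `R0` and `r < 1` in operator
  norm it is automatic, not used here);
* **`exists_chartFamily_of_contraction`** (algebra-valued unknown `A` in the tower chart `expChartT P R0`, centre `A = 0 ↦ R0`,
  `ComplexBackgroundFamily.ofChart` — no invertibility hypothesis; the shape of [B9] Sect. B «U′U, U′ = e^{iηA}» and of (1.12)).
DISGUISE TEST: packaging of `NE9AnalyticFixedPoint` §4 into the substrate structure; no inequality of the series; not NE9; 0 def, 0 sorry.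

References (TYPES ∕ loci only): [Balaban1988RG2Cluster] T. Bałaban, CMP **116** (1988) 1–22, p. 5 (1.12)–(1.14); [Balaban1987RG1]
T. Bałaban, CMP **109** (1987) 249–301, Lemma 4 (3.53) p. 280 (the QUANTITATIVE clauses this mechanism can carry once B2∕B3 exist);
[Balaban1985BackgroundPropagators] CMP **99** (1985) Sect. B pp. 399–400.  Imports `NE9AnalyticFixedPoint` + `SubstrateComplexBackground`
ONLY; modifies nothing.  Value = route-R2 kernel adapter (B4), NOT summit progress.
-/

noncomputable section

open scoped Topology NNReal Matrix Matrix.Norms.L2Operator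
open Metric Set Filter

namespace Summit.QuantumFields.BalabanUV.T4Continuum.NE9ComplexBackgroundOfContraction

open Literature.MathematicalPhysics.QuantumFieldTheory.Balaban1983to89
open Literature.MathematicalPhysics.QuantumFieldTheory.Balaban1983to89.B5Prop11Plancherel (Tor fine)
open Literature.MathematicalPhysics.QuantumFieldTheory.Balaban1983to89.B5G183RateUnitTower (lev)
open Summit.QuantumFields.BalabanUV.T4Continuum.SubstrateBackgroundTransporters (unitMod)
open Summit.QuantumFields.BalabanUV.T4Continuum.SubstrateTransporterSpecies (TowerData)
open Summit.QuantumFields.BalabanUV.T4Continuum.SubstrateTransporterSpeciesHolo (expChartT)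
open Summit.QuantumFields.BalabanUV.T4Continuum.SubstrateComplexBackground (ComplexBackgroundFamily)
open Summit.QuantumFields.BalabanUV.T4Continuum.NE9AnalyticFixedPoint

variable (P : Params) {o : Type*} [Fintype o] [DecidableEq o]
variable {Ξ : Type*} [NormedAddCommGroup Ξ] [NormedSpace ℂ Ξ] [CompleteSpace Ξ]

/-- **A UNIFORM CONTRACTION ABOUT THE BACKGROUND OF RECORD, ANALYTIC IN THE PARAMETER, GIVES A COMPLEX BACKGROUND FAMILY ON THE
PRESCRIBED BALL** (group-valued unknown).  Let `R0` be tower data, `0 < ρ`, `0 ≤ r < r'`, `K < 1`; for `ξ ∈ ball 0 ρ` let `T ξ` send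
`closedBall R0 r` into itself and be `K`-Lipschitz on `ball R0 r'`, let `(ξ, R) ↦ T ξ R` be analytic on `ball 0 ρ ×ˢ ball R0 r'`, let
`T 0 R0 = R0` (the real background of record is the fixed point at the centre), and let every `R ∈ closedBall R0 r` be invertible bond by
bond.  Then there is `Fm : ComplexBackgroundFamily P Ξ R0 ρ` — ON THE PRESCRIBED `ρ` — whose `uC` is the fixed-point section:
`uC ξ ∈ closedBall R0 r`, `T ξ (uC ξ) = uC ξ`, UNIQUE in that closed ball, `dist (uC ξ) R ≤ dist (T ξ R) R ∕ (1 − K)` for every `R` in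
it, and `AnalyticOnNhd ℂ uC (ball 0 ρ)`.  [folklore mechanism; cf. [II] p. 5 after (1.13)] -/
theorem exists_complexBackgroundFamily_of_contraction {R0 : TowerData P o} {ρ r r' : ℝ} (hρ : 0 < ρ) (hr : 0 ≤ r)
    (hrr' : r < r') {K : ℝ≥0} (hK : (K : ℝ) < 1) (T : Ξ → TowerData P o → TowerData P o)
    (hmaps : ∀ ξ ∈ ball (0 : Ξ) ρ, MapsTo (T ξ) (closedBall R0 r) (closedBall R0 r))
    (hlip : ∀ ξ ∈ ball (0 : Ξ) ρ, LipschitzOnWith K (T ξ) (ball R0 r'))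
    (hT : AnalyticOnNhd ℂ (fun q : Ξ × TowerData P o => T q.1 q.2) (ball (0 : Ξ) ρ ×ˢ ball R0 r'))
    (h0 : T 0 R0 = R0)
    (hunit : ∀ R ∈ closedBall R0 r, ∀ (k : Fin (P.K + 1)) ν b, IsUnit (R k ν b).det) :
    ∃ Fm : ComplexBackgroundFamily P Ξ R0 ρ,
      (∀ ξ ∈ ball (0 : Ξ) ρ, Fm.uC ξ ∈ closedBall R0 r ∧ T ξ (Fm.uC ξ) = Fm.uC ξ) ∧
      (∀ ξ ∈ ball (0 : Ξ) ρ, ∀ R ∈ closedBall R0 r, T ξ R = R → R = Fm.uC ξ) ∧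
      (∀ ξ ∈ ball (0 : Ξ) ρ, ∀ R ∈ closedBall R0 r, dist (Fm.uC ξ) R ≤ dist (T ξ R) R / (1 - K)) ∧
      AnalyticOnNhd ℂ Fm.uC (ball (0 : Ξ) ρ) := by
  haveI : CompleteSpace (TowerData P o) := FiniteDimensional.complete ℂ _
  obtain ⟨x, hxa, hfix, huniq, hap⟩ :=
    exists_analyticOnNhd_fixedPt_section T isOpen_ball hr hrr' hK hmaps hlip hT
  have hx0 : x 0 = R0 := (huniq 0 (mem_ball_self hρ) R0 (mem_closedBall_self hr) h0).symm
  have hd : ∀ (k : Fin (P.K + 1)) ν b, DifferentiableOn ℂ (fun ξ => x ξ k ν b) (ball (0 : Ξ) ρ) := fun k ν b =>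
    differentiableOn_pi.1 (differentiableOn_pi.1 (differentiableOn_pi.1 hxa.differentiableOn k) ν) b
  have hu : ∀ ξ ∈ ball (0 : Ξ) ρ, ∀ (k : Fin (P.K + 1)) ν b, IsUnit (x ξ k ν b).det :=
    fun ξ hξ => hunit (x ξ) (hfix ξ hξ).1
  exact ⟨ComplexBackgroundFamily.ofInvertible R0 ρ x hx0 hd hu, hfix, huniq, hap, hxa⟩

/-- **THE SAME IN THE TOWER CHART** (algebra-valued unknown; no invertibility hypothesis).  Let `0 < ρ`, `0 ≤ r < r'`, `K < 1`; for
`ξ ∈ ball 0 ρ` let `T ξ` send `closedBall 0 r ⊆ TowerData P o` into itself and be `K`-Lipschitz on `ball 0 r'`, let `(ξ, A) ↦ T ξ A`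
be analytic on `ball 0 ρ ×ˢ ball 0 r'`, and `T 0 0 = 0`.  Then the fixed-point section `A` (`A 0 = 0`, analytic on `ball 0 ρ`, valued in
`closedBall 0 r`, unique there, `dist (A ξ) A' ≤ dist (T ξ A') A' ∕ (1 − K)`) read through the tower chart,
`uC ξ := expChartT P R0 (A ξ)`, is a `ComplexBackgroundFamily P Ξ R0 ρ` (`ComplexBackgroundFamily.ofChart`) — the shape of
[II] (1.12) ∕ [B9] Sect. B «U′U, U′ = e^{iηA}».  [folklore mechanism] -/
theorem exists_chartFamily_of_contraction (R0 : TowerData P o) {ρ r r' : ℝ} (hρ : 0 < ρ) (hr : 0 ≤ r)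
    (hrr' : r < r') {K : ℝ≥0} (hK : (K : ℝ) < 1) (T : Ξ → TowerData P o → TowerData P o)
    (hmaps : ∀ ξ ∈ ball (0 : Ξ) ρ, MapsTo (T ξ) (closedBall 0 r) (closedBall 0 r))
    (hlip : ∀ ξ ∈ ball (0 : Ξ) ρ, LipschitzOnWith K (T ξ) (ball 0 r'))
    (hT : AnalyticOnNhd ℂ (fun q : Ξ × TowerData P o => T q.1 q.2) (ball (0 : Ξ) ρ ×ˢ ball 0 r'))
    (h0 : T 0 0 = 0) :
    ∃ A : Ξ → TowerData P o, ∃ Fm : ComplexBackgroundFamily P Ξ R0 ρ,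
      (∀ ξ, Fm.uC ξ = expChartT P R0 (A ξ)) ∧ A 0 = 0 ∧ AnalyticOnNhd ℂ A (ball (0 : Ξ) ρ) ∧
      (∀ ξ ∈ ball (0 : Ξ) ρ, A ξ ∈ closedBall (0 : TowerData P o) r ∧ T ξ (A ξ) = A ξ) ∧
      (∀ ξ ∈ ball (0 : Ξ) ρ, ∀ A' ∈ closedBall (0 : TowerData P o) r, T ξ A' = A' → A' = A ξ) ∧
      (∀ ξ ∈ ball (0 : Ξ) ρ, ∀ A' ∈ closedBall (0 : TowerData P o) r, dist (A ξ) A' ≤ dist (T ξ A') A' / (1 - K)) := by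
  haveI : CompleteSpace (TowerData P o) := FiniteDimensional.complete ℂ _
  obtain ⟨x, hxa, hfix, huniq, hap⟩ :=
    exists_analyticOnNhd_fixedPt_section T isOpen_ball hr hrr' hK hmaps hlip hT
  have hx0 : x 0 = 0 := (huniq 0 (mem_ball_self hρ) 0 (mem_closedBall_self hr) h0).symm
  have hd : ∀ (k : Fin (P.K + 1)) ν b, DifferentiableOn ℂ (fun ξ => x ξ k ν b) (ball (0 : Ξ) ρ) := fun k ν b =>
    differentiableOn_pi.1 (differentiableOn_pi.1 (differentiableOn_pi.1 hxa.differentiableOn k) ν) b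
  exact ⟨x, ComplexBackgroundFamily.ofChart R0 ρ x hx0 hd, fun _ => rfl, hx0, hxa, hfix, huniq, hap⟩

end Summit.QuantumFields.BalabanUV.T4Continuum.NE9ComplexBackgroundOfContraction

end
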